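import Literature.Barriers.MatrixMultiplication.UniversalMethodBarrier
import Literature.Computability.AlgebraicComplexity.KoszulFlatteningBorderRank
import HarnessLib

/-!
# Flattening ranks along a polynomial degeneration (every characteristic)

Solo seat `solo-MatrixMultiplication-informed` (generation 28); support file for
`SoloInformedConverseDoorFormats`.  The first flattening `flatA T : K^α → K^β ⊗ K^γ` of a tensor of
any format is functorial under substitutions, `flatA((A,B,C)·t) = Aᵀ · flatA(t) · (B ⊗ C)`
(`flatA_subst`), hence its rank is monotone along Alman's `PolyDegeneratesTo` in every
characteristic (`rank_flatA_le_of_polyDegeneratesTo`, via the tree's algebraic semicontinuity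
lemma `rank_le_rank_map_of_perturbation` over `K(ε)`); so `t ⊵ s` with `s` concise in the first
leg forces `|rows of t| ≥ |rows of s|` (`card_le_of_polyDegeneratesTo`).  The other legs are reached
by permuting the legs of a degeneration (`polyDegeneratesTo_swap`, `polyDegeneratesTo_rot`), and
`rank_eq_card_of_mul_eq_diagonal` is the conciseness test used downstream (a "monomial" square
submatrix with non-zero diagonal).

## References
* J. M. Landsberg, G. Ottaviani, *New lower bounds for the border rank of matrix
  multiplication*, Theory of Computing 11 (2015), Thm 2.1 (semicontinuity of flattening ranks).
  [LandsbergOttaviani2015]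
* J. Alman, *Limits on the universal method for matrix multiplication*, Theory of Computing 17
  (2021), §2.4. [Alman2021]
-/

open scoped BigOperators Polynomial Kronecker

namespace Summit.MatrixMultiplication.MatrixMultiplication.Theorems

open Matrix Finset Module
open Literature.Computability.AlgebraicComplexity Literature.Barriers.MatrixMultiplication

universe u

set_option linter.unusedSectionVars false

namespace FlatDegen

/-! ## The first flattening -/

section Flat

variable {R : Type*} [CommRing R] {α β γ : Type*} [Fintype α] [Fintype β] [Fintype γ]

/-- The first flattening `(flatA T)_{a,(b,c)} = T_{abc}` of a tensor of any format. [folklore] -/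
def flatA (T : α → β → γ → R) : Matrix α (β × γ) R := Matrix.of fun a bc => T a bc.1 bc.2

/-- Entries of `flatA`. [folklore] -/
@[simp] theorem flatA_apply (T : α → β → γ → R) (a : α) (bc : β × γ) :
    flatA T a bc = T a bc.1 bc.2 := rfl

/-- `flatA` is additive. [folklore] -/
theorem flatA_add (T T' : α → β → γ → R) : flatA (T + T') = flatA T + flatA T' := by
  ext a bc; rfl

/-- `flatA` is homogeneous. [folklore] -/
theorem flatA_smul (x : R) (T : α → β → γ → R) : flatA (x • T) = x • flatA T := by
  ext a bc; rfl

/-- `flatA` commutes with ring maps. [folklore] -/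
theorem flatA_map {S : Type*} [CommRing S] (f : R →+* S) (T : α → β → γ → R) :
    flatA (fun a b c => f (T a b c)) = (flatA T).map f := by
  ext a bc; rfl

/-- **Functoriality**: the flattening of the substituted tensor
`t'_{a'b'c'} = Σ t_{abc} A_{aa'} B_{bb'} C_{cc'}` is `Aᵀ · flatA t · (B ⊗ C)`.
[cite: LandsbergOttaviani2015, Thm 2.1 (proof)] -/
theorem flatA_subst {α' β' γ' : Type*} (t : α → β → γ → R) (A : α → α' → R) (B : β → β' → R)
    (C : γ → γ' → R) :
    flatA (fun a' b' c' => ∑ a, ∑ b, ∑ c, t a b c * (A a a' * B b b' * C c c')) =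
      (Matrix.of A)ᵀ * flatA t * ((Matrix.of B) ⊗ₖ (Matrix.of C)) := by
  ext a' bc'
  rw [Matrix.mul_apply, Fintype.sum_prod_type]
  simp only [flatA_apply, Matrix.mul_apply, Matrix.transpose_apply, Matrix.of_apply,
    Matrix.kroneckerMap_apply, Finset.sum_mul]
  rw [Finset.sum_comm]
  refine Finset.sum_congr rfl fun b _ => ?_
  rw [Finset.sum_comm]
  exact Finset.sum_congr rfl fun c _ => Finset.sum_congr rfl fun a _ => by ring

end Flat

/-! ## Permuting the legs of a degeneration -/

section Legs

variable {K : Type u} [Field K] {ι κ μ ι' κ' μ' : Type*} [Fintype ι] [Fintype κ] [Fintype μ]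

/-- A degeneration `t ⊵ s` is also one after exchanging the first two legs of both tensors.
[cite: Alman2021, §2.4] -/
theorem polyDegeneratesTo_swap {t : ι → κ → μ → K} {s : ι' → κ' → μ' → K}
    (hts : PolyDegeneratesTo t s) :
    PolyDegeneratesTo (fun b a c => t a b c) (fun b a c => s a b c) := by
  obtain ⟨h, A, B, C, hs⟩ := hts
  refine ⟨h, B, A, C, fun b' a' c' j hj => ?_⟩
  have e : (∑ b, ∑ a, ∑ c, Polynomial.C (t a b c) * (B b b' * A a a' * C c c')) =
      ∑ a, ∑ b, ∑ c, Polynomial.C (t a b c) * (A a a' * B b b' * C c c') := by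
    rw [Finset.sum_comm]
    exact Finset.sum_congr rfl fun a _ => Finset.sum_congr rfl fun b _ =>
      Finset.sum_congr rfl fun c _ => by ring
  rw [e]
  exact hs a' b' c' j hj

/-- A degeneration `t ⊵ s` is also one after moving the third leg of both tensors to the front.
[cite: Alman2021, §2.4] -/
theorem polyDegeneratesTo_rot {t : ι → κ → μ → K} {s : ι' → κ' → μ' → K}
    (hts : PolyDegeneratesTo t s) :
    PolyDegeneratesTo (fun c a b => t a b c) (fun c a b => s a b c) := by
  obtain ⟨h, A, B, C, hs⟩ := hts
  refine ⟨h, C, A, B, fun c' a' b' j hj => ?_⟩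
  have e : (∑ c, ∑ a, ∑ b, Polynomial.C (t a b c) * (C c c' * A a a' * B b b')) =
      ∑ a, ∑ b, ∑ c, Polynomial.C (t a b c) * (A a a' * B b b' * C c c') := by
    rw [Finset.sum_comm]
    refine Finset.sum_congr rfl fun a _ => ?_
    rw [Finset.sum_comm]
    exact Finset.sum_congr rfl fun b _ => Finset.sum_congr rfl fun c _ => by ring
  rw [e]
  exact hs a' b' c' j hj

end Legs

/-! ## Semicontinuity of the flattening rank along a degeneration (every characteristic) -/

section Semicontinuity

variable {K : Type u} [Field K] {ι κ μ ι' κ' μ' : Type*} [Fintype ι] [Fintype κ] [Fintype μ]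
  [Fintype ι'] [Fintype κ'] [Fintype μ']

/-- **Semicontinuity of the first flattening rank.**  If `t ⊵ s` and the first flattening of `t`
has rank `≤ B` over every field extension of `K`, then so does that of `s`: the degenerating
family is `εʰ (s + ε s₁) = (A,B,C)(ε) · t` over `K[ε]`; flatten, compare ranks over `K(ε)` with the
tree's `rank_le_rank_map_of_perturbation`, and use functoriality.
[cite: LandsbergOttaviani2015, Thm 2.1 (proof)] [cite: Alman2021, §2.4] -/
theorem rank_flatA_le_of_polyDegeneratesTo {t : ι → κ → μ → K} {s : ι' → κ' → μ' → K}
    (hts : PolyDegeneratesTo t s) {B : ℕ}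
    (hB : ∀ (L : Type u) [Field L] [Algebra K L],
      (flatA (fun a b c => algebraMap K L (t a b c))).rank ≤ B) :
    (flatA s).rank ≤ B := by
  classical
  obtain ⟨h, A, Bm, Cm, hs⟩ := hts
  set T : ι' → κ' → μ' → K[X] :=
    fun a' b' c' => ∑ a, ∑ b, ∑ c, Polynomial.C (t a b c) * (A a a' * Bm b b' * Cm c c')
    with hTdef
  have hdvd : ∀ a' b' c', (Polynomial.X : K[X]) ^ (h + 1) ∣
      T a' b' c' - Polynomial.C (s a' b' c') * Polynomial.X ^ h := by
    intro a' b' c'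
    rw [Polynomial.X_pow_dvd_iff]
    intro d hd
    rw [Polynomial.coeff_sub, Polynomial.coeff_C_mul_X_pow, hs a' b' c' d (by omega)]
    split_ifs <;> simp
  choose T' hT' using hdvd
  have hTe : T = (Polynomial.X : K[X]) ^ h •
      ((fun a' b' c' => Polynomial.C (s a' b' c')) + (Polynomial.X : K[X]) • T') := by
    funext a' b' c'
    simp only [Pi.smul_apply, Pi.add_apply, smul_eq_mul]
    linear_combination hT' a' b' c'
  have hKF : flatA T = (Polynomial.X : K[X]) ^ h •
      ((flatA s).map (Polynomial.C : K →+* K[X]) + (Polynomial.X : K[X]) • flatA T') := by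
    rw [hTe, flatA_smul, flatA_add, flatA_smul, flatA_map]
  have hN : ∀ i j, flatA T i j =
      (Polynomial.C (flatA s i j) + Polynomial.X * flatA T' i j) * Polynomial.X ^ h := by
    intro i j
    rw [hKF]
    simp only [Matrix.smul_apply, Matrix.add_apply, Matrix.map_apply, smul_eq_mul]
    ring
  let L := FractionRing K[X]
  have key := rank_le_rank_map_of_perturbation (L := L) (flatA s) (flatA T') (flatA T) h hN
  refine key.trans ?_
  rw [← flatA_map]
  have hmapT : (fun a' b' c' => algebraMap K[X] L (T a' b' c')) = fun a' b' c' =>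
      ∑ a, ∑ b, ∑ c, algebraMap K L (t a b c) *
        (algebraMap K[X] L (A a a') * algebraMap K[X] L (Bm b b') *
          algebraMap K[X] L (Cm c c')) := by
    funext a' b' c'
    simp only [hTdef, map_sum, map_mul]
    refine Finset.sum_congr rfl fun a _ => Finset.sum_congr rfl fun b _ =>
      Finset.sum_congr rfl fun c _ => ?_
    rw [IsScalarTower.algebraMap_apply K K[X] L, Polynomial.algebraMap_eq]
  rw [hmapT, flatA_subst]
  exact ((Matrix.rank_mul_le_left _ _).trans (Matrix.rank_mul_le_right _ _)).trans (hB L)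

/-- **Format bound.**  If `t ⊵ s` and `s` is concise in the first leg (`rank flatA s = |ι'|`), then
`|ι'| ≤ |ι|`: the flattening rank of `t` over any field is at most its number of rows.
[cite: LandsbergOttaviani2015, Thm 2.1] -/
theorem card_le_of_polyDegeneratesTo {t : ι → κ → μ → K} {s : ι' → κ' → μ' → K}
    (hts : PolyDegeneratesTo t s) (hs : (flatA s).rank = Fintype.card ι') :
    Fintype.card ι' ≤ Fintype.card ι := by
  have := rank_flatA_le_of_polyDegeneratesTo hts (B := Fintype.card ι)
    fun L _ _ => Matrix.rank_le_card_height _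
  rwa [hs] at this

end Semicontinuity

/-! ## A conciseness test -/

section Diagonal

variable {ι : Type*} [Fintype ι] [DecidableEq ι] {F : Type*} [Field F]

/-- A square matrix over a field whose product with some matrix is a diagonal matrix with non-zero
diagonal has full rank. [folklore] -/
theorem rank_eq_card_of_mul_eq_diagonal {κ' : Type*} [Fintype κ'] (M : Matrix ι κ' F)
    (Q : Matrix κ' ι F) (w : ι → F) (hw : ∀ i, w i ≠ 0) (hMQ : M * Q = Matrix.diagonal w) :
    M.rank = Fintype.card ι := by
  apply le_antisymm (Matrix.rank_le_card_height _)
  have hU : IsUnit (Matrix.diagonal w) := by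
    rw [Matrix.isUnit_iff_isUnit_det, Matrix.det_diagonal, isUnit_iff_ne_zero]
    exact Finset.prod_ne_zero_iff.2 fun i _ => hw i
  calc Fintype.card ι = (Matrix.diagonal w).rank := (Matrix.rank_of_isUnit _ hU).symm
    _ = (M * Q).rank := by rw [hMQ]
    _ ≤ M.rank := Matrix.rank_mul_le_left _ _

end Diagonal

end FlatDegen

end Summit.MatrixMultiplication.MatrixMultiplication.Theorems
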